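import Summits.FinalStateConjecture.FinalStateConjecture.Theses.BurnettKineticRigidity
import HarnessLib

/-!
# Birth skeleton — crux stmt-FinalStateConjecture-17292 `Theses.BurnettKineticRigidity.SettlesOutsidePhotonRegions` (A, rank 2)
# line `birth` (skeleton registrar planner-skel-stmt-FinalStateConjecture-17292-0, 2026-08-17; BC3 of run/shared/lean/lens3/_common/BC.md)

A (CENSORED DICHOTOMY): every maximal vacuum Cauchy development `𝒟` of admissible data with complete `𝓘⁺` EITHER
settles in the summit's sense (sub-extremal exhaustive `C²` decomposition of `O = exteriorOf 𝒟 d.charted` with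
`RaysStayInClosure`, honest radii, future-oriented charts) OR carries a PHOTON-REGION REMNANT (a late chart `Ψ` on a
Kerr background `(M, a)`, `0 < M`, `|a| ≤ M`, into `J⁺(ιX)` in which `Ψ^*g − g_(M,a) → 0` in `C²` on every annular
slab `{t* = τ, ρ ≤ r ≤ R}`).

The cut follows the route's own TWO-LAYER PLAN for A (route header: late-time Burnett compactness + identification
+ non-radiating ω-limits + kinetic rigidity of Einstein–massless-Vlasov ⇒ "Kerr outside a bounded radius", then the
`BurnettToC2Upgrade`), typed over the landed definitions `Spacetime.lateTimeBurnettOmegaLimitSet`,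
`Spacetime.HasUniformBurnettBounds` (Literature.Geometry.Lorentzian.LateTimeOmegaLimitSet) and the Kerr–Schild
components `Kerr.bilin`:

* `stub_omegaLimitsKerrOutside` (K, the KINETIC CORE; open-problem sized): every censored MGHD of admissible data
  either settles (summit sense, verbatim) or admits a late chart `Ψ` on some `Kerr.background M a` (`0 < M`,
  `|a| ≤ M`) into `J⁺(ιX)` with uniform Burnett (`C¹`) bounds on a slab `S_L = {τ₀ < t* < τ₀ + L}`, `L > 0`, ALL of
  whose late-time Burnett ω-limits coincide with the Kerr–Schild components `g_(M,a)` outside a bounded radius `ρ`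
  on `S_L`.  This is the data-level output of H1 (a-priori Huneau–Luk bounds) + `LateTimeBurnettPrecompactness`
  (landed) + `LateTimeBurnettIdentification` (#6) + `OmegaLimitsNonRadiating` (#7) + `KineticRigidityEMV` (#5):
  non-radiating Einstein–massless-Vlasov ω-limits are Kerr (`f = 0`) or carry photon shells at bounded radius, and
  are EXACTLY Kerr outside them.  Why it might fail: drifting parameters `(M(τ), a(τ))` give ω-limits that are Kerr
  with DIFFERENT parameters along different subsequences; a rotating kinetic remnant is not exactly Kerr at any
  radius (no Birkhoff beyond spherical symmetry, arXiv:2202.10245); the chart's gauge must be rigid enough that every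
  subsequential limit lands in Kerr–Schild form.  Weaker than the remnant disjunct in regularity (Lipschitz/`C⁰`
  limits, not `C²`), stronger in extent (bounds on the whole slab, inside `ρ` too): incomparable with A.
* `stub_annularC2Upgrade` (U, the WEAK-TO-`C²` UPGRADE = the route's `BurnettToC2Upgrade`, typed; L/XL): for a
  censored MGHD of admissible data and such a chart, "all Burnett ω-limits are `g_(M,a)` outside `ρ`" upgrades to
  the `C²` annular convergence of the remnant disjunct (verbatim).  Soft half: precompactness + uniqueness of the
  limit ⇒ `C⁰`/Lipschitz convergence of the translates on the outer slab; hard half: vacuum + no Vlasov part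
  outside `ρ` ⇒ no residual curvature ripples.  Why it might fail: vanishing-energy high-frequency ripples
  (amplitude `λ²`, frequency `λ⁻¹`: Burnett limit still Kerr, `C²` deviation `O(1)`) crossing the annuli at
  arbitrarily late times are invisible to K and are excluded only by a pointwise curvature-decay mechanism
  (qualitative Price-law territory; barrier `PriceLawTail` is not touched: no rate is claimed).

Composition `SettlesOutsidePhotonRegions_of : Sig.stub_omegaLimitsKerrOutside → Sig.stub_annularC2Upgrade →
SettlesOutsidePhotonRegions` (the `Sig.*` legend = the stub signatures verbatim, so that the implication form has
named binders; the registered stubs themselves are DEF-FREE and self-contained via `open … in`), and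
`settlesOutsidePhotonRegions_of_stubs : SettlesOutsidePhotonRegions` = the crux BY NAME, closed modulo the two stubs.
Disproof.lean: none exists for this crux (no `_false_without_` obligations to honour; `ledger crux ls` empty at
registration).  Negatives index (1 entry, `not_UniformPhotonSphereChannels`): unrelated ODE channel estimate.
-/

set_option linter.dupNamespace false

noncomputable section

open scoped Manifold ContDiff Topology
open Filter Set Function Literature.Geometry.Lorentzian

namespace Summit.FinalStateConjecture.FinalStateConjecture.Cruxes.SettlesOutsidePhotonRegions.Birth

open Summit.FinalStateConjecture.FinalStateConjecture.Theses.BurnettKineticRigidity (SettlesOutsidePhotonRegions)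

/-! ## Legend: the two stub statements as named propositions (verbatim the registered signatures) -/

/-- Statement of `stub_omegaLimitsKerrOutside` (K): settles, or a bounded late Kerr–Schild chart all of whose
late-time Burnett ω-limits are exactly `g_(M,a)` outside radius `ρ`. -/
def Sig.stub_omegaLimitsKerrOutside : Prop :=
  open Literature.Geometry.Lorentzian in open scoped Manifold ContDiff in ∀ (X : Type) [TopologicalSpace X] [ChartedSpace E3 X] [IsManifold (𝓡 3) ∞ X] [T2Space X] [SecondCountableTopology X] [ConnectedSpace X], ∀ D ∈ admissibleVacuumData X, ∀ 𝒟 : VacuumCauchyDevelopment D, 𝒟.IsMaximal → Summit.FinalStateConjecture.HasCompleteNullInfinity 𝒟.toCauchyDevelopment → (∃ (O : Set 𝒟.carrier) (d : FinalStateDecomposition 𝒟.toSpacetime O 2), (∀ i, Kerr.IsSubextremal (d.mass i) (d.spin i)) ∧ O = Summit.FinalStateConjecture.exteriorOf 𝒟.toCauchyDevelopment d.charted ∧ Summit.FinalStateConjecture.RaysStayInClosure 𝒟.toCauchyDevelopment O ∧ Summit.FinalStateConjecture.HasExhaustiveCharts d ∧ Summit.FinalStateConjecture.IsFutureOriented d)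 ∨ ∃ (M a ρ τ₀ L : ℝ) (Ψ : ↥(Kerr.background M a).domain → 𝒟.carrier), 0 < M ∧ |a| ≤ M ∧ 0 < L ∧ 𝒟.toSpacetime.IsLateChart (Kerr.background M a) (𝒟.metric.causalFuture 𝒟.timeOrientation (Set.range 𝒟.embed)) τ₀ Ψ ∧ 𝒟.toSpacetime.HasUniformBurnettBounds (Kerr.background M a) Ψ τ₀ L ∧ (∀ g ∈ 𝒟.toSpacetime.lateTimeBurnettOmegaLimitSet (Kerr.background M a) Ψ τ₀ L, ∀ x : ↥(Kerr.background M a).domain, x ∈ (Kerr.background M a).timeSlabIoo τ₀ L → ρ ≤ Kerr.radius a x → g x = Kerr.bilin M a x)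

/-- Statement of `stub_annularC2Upgrade` (U): such a chart upgrades to `C²` annular convergence outside `ρ`. -/
def Sig.stub_annularC2Upgrade : Prop :=
  open Literature.Geometry.Lorentzian in open scoped Manifold ContDiff in ∀ (X : Type) [TopologicalSpace X] [ChartedSpace E3 X] [IsManifold (𝓡 3) ∞ X] [T2Space X] [SecondCountableTopology X] [ConnectedSpace X], ∀ D ∈ admissibleVacuumData X, ∀ 𝒟 : VacuumCauchyDevelopment D, 𝒟.IsMaximal → Summit.FinalStateConjecture.HasCompleteNullInfinity 𝒟.toCauchyDevelopment → ∀ (M a ρ τ₀ L : ℝ) (Ψ : ↥(Kerr.background M a).domain → 𝒟.carrier), 0 < M → |a| ≤ M → 0 < L → 𝒟.toSpacetime.IsLateChart (Kerr.background M a) (𝒟.metric.causalFuture 𝒟.timeOrientation (Set.range 𝒟.embed)) τ₀ Ψ → 𝒟.toSpacetime.HasUniformBurnettBounds (Kerr.background M a) Ψ τ₀ L → (∀ g ∈ 𝒟.toSpacetime.lateTimeBurnettOmegaLimitSet (Kerr.background M a) Ψ τ₀ L, ∀ x : ↥(Kerr.background M a).domain, x ∈ (Kerr.background M a).timeSlabIoo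 τ₀ L → ρ ≤ Kerr.radius a x → g x = Kerr.bilin M a x) → ∀ R : ℝ, Filter.Tendsto (fun τ : ℝ ↦ supCkENorm (Subtype.val '' {x : ↥(Kerr.background M a).domain | (x : E4) 0 = τ ∧ ρ ≤ Kerr.radius a x ∧ Kerr.radius a x ≤ R}) 2 (𝒟.toSpacetime.deviationExtend (Kerr.background M a) Ψ)) Filter.atTop (nhds 0)

/-! ## Registered stubs (`sorry` only here; signatures def-free and self-contained) -/

/-- **K — ω-LIMITS ARE KERR OUTSIDE A BOUNDED RADIUS, OR THE DEVELOPMENT SETTLES** (kinetic core of route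
BurnettKineticRigidity at data level: a-priori Huneau–Luk bounds H1 + late-time Burnett precompactness (landed,
stmt-14100) + identification of ω-limits as weak Einstein–massless-Vlasov (#6, stmt-14378) + non-radiating ω-limits
(#7) + kinetic rigidity (#5): non-radiating AF EMV black-hole exteriors are Kerr with `f = 0` — then the `C²`
upgrade child + Kerr stability gives the summit's settles clause — or self-gravitating photon configurations at
bounded radius, EXACTLY Kerr outside).  For every admissible datum and every MGHD with complete `𝓘⁺`: settles
(summit sense, verbatim) ∨ ∃ `(M, a, ρ, τ₀, L, Ψ)`, `0 < M`, `|a| ≤ M`, `0 < L`, `Ψ` a late chart on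
`Kerr.background M a` into `J⁺(ιX)` after `τ₀` with `HasUniformBurnettBounds` on `S_L` and every
`g_∞ ∈ lateTimeBurnettOmegaLimitSet` equal to `Kerr.bilin M a` at every point of `S_L` with `r ≥ ρ`.
Why it might fail: parameter drift (different subsequential Kerr limits), non-Kerr multipoles of a rotating kinetic
remnant at every radius (arXiv:2202.10245), gauge rigidity of the chart.  Sources: arXiv:2403.03470, arXiv:1907.10743,
arXiv:1709.03952, arXiv:2102.08170, arXiv:1511.01290.  Size: open-problem. -/
theorem stub_omegaLimitsKerrOutside : open Literature.Geometry.Lorentzian in open scoped Manifold ContDiff in ∀ (X : Type) [TopologicalSpace X] [ChartedSpace E3 X] [IsManifold (𝓡 3) ∞ X] [T2Space X] [SecondCountableTopology X] [ConnectedSpace X], ∀ D ∈ admissibleVacuumData X, ∀ 𝒟 : VacuumCauchyDevelopment D, 𝒟.IsMaximal → Summit.FinalStateConjecture.HasCompleteNullInfinity 𝒟.toCauchyDevelopment → (∃ (O : Set 𝒟.carrier) (d : FinalStateDecomposition 𝒟.toSpacetime O 2), (∀ i, Kerr.IsSubextremal (d.mass i) (d.spin i)) ∧ O = Summit.FinalStateConjecture.exteriorOf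 𝒟.toCauchyDevelopment d.charted ∧ Summit.FinalStateConjecture.RaysStayInClosure 𝒟.toCauchyDevelopment O ∧ Summit.FinalStateConjecture.HasExhaustiveCharts d ∧ Summit.FinalStateConjecture.IsFutureOriented d) ∨ ∃ (M a ρ τ₀ L : ℝ) (Ψ : ↥(Kerr.background M a).domain → 𝒟.carrier), 0 < M ∧ |a| ≤ M ∧ 0 < L ∧ 𝒟.toSpacetime.IsLateChart (Kerr.background M a) (𝒟.metric.causalFuture 𝒟.timeOrientation (Set.range 𝒟.embed)) τ₀ Ψ ∧ 𝒟.toSpacetime.HasUniformBurnettBounds (Kerr.background M a) Ψ τ₀ L ∧ (∀ g ∈ 𝒟.toSpacetime.lateTimeBurnettOmegaLimitSet (Kerr.background M a) Ψ τ₀ L, ∀ x : ↥(Kerr.background M a).domain, x ∈ (Kerr.background M a).timeSlabIoo τ₀ L → ρ ≤ Kerr.radius a x → g x = Kerr.bilin M a x) := by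
  sorry

/-- **U — ANNULAR `C²` UPGRADE** (the route's `BurnettToC2Upgrade`, typed): for a censored MGHD of admissible data
and a late chart `Ψ` on `Kerr.background M a` (`0 < M`, `|a| ≤ M`) into `J⁺(ιX)` with uniform Burnett bounds on
`S_L`, `L > 0`, all of whose late-time Burnett ω-limits equal `g_(M,a)` outside radius `ρ` on `S_L`, the `C²`
sup-norm of `Ψ^*g − g_(M,a)` on every annular slab `{t* = τ, ρ ≤ r ≤ R}` tends to `0` as `τ → ∞` (verbatim the
remnant disjunct's convergence).  Soft half (Hale ω-limit bookkeeping + `LateTimeBurnettPrecompactness`): unique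
limit point ⇒ locally uniform convergence with Lipschitz bounds on the outer slab; hard half: vacuum Einstein +
vanishing Vlasov part outside `ρ` ⇒ `C²` convergence (no concentration / oscillation residue).  Why it might fail:
vanishing-energy curvature ripples (amplitude `λ²`, frequency `λ⁻¹`) recurring on the annuli at late times have
Burnett limit Kerr but `C²` deviation `O(1)`; only a pointwise decay mechanism excludes them.  Sources:
arXiv:2403.03470 (Rem. 1.3, Def. 4.1), arXiv:2402.17530, Hale1980 Ch. I §8, arXiv:2104.08222 §1.  Size: L/XL. -/
theorem stub_annularC2Upgrade : open Literature.Geometry.Lorentzian in open scoped Manifold ContDiff in ∀ (X : Type) [TopologicalSpace X] [ChartedSpace E3 X] [IsManifold (𝓡 3) ∞ X] [T2Space X] [SecondCountableTopology X] [ConnectedSpace X], ∀ D ∈ admissibleVacuumData X, ∀ 𝒟 : VacuumCauchyDevelopment D, 𝒟.IsMaximal → Summit.FinalStateConjecture.HasCompleteNullInfinity 𝒟.toCauchyDevelopment → ∀ (M a ρ τ₀ L : ℝ) (Ψ : ↥(Kerr.background M a).domain → 𝒟.carrier), 0 < M → |a| ≤ M → 0 < L → 𝒟.toSpacetime.IsLateChart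 (Kerr.background M a) (𝒟.metric.causalFuture 𝒟.timeOrientation (Set.range 𝒟.embed)) τ₀ Ψ → 𝒟.toSpacetime.HasUniformBurnettBounds (Kerr.background M a) Ψ τ₀ L → (∀ g ∈ 𝒟.toSpacetime.lateTimeBurnettOmegaLimitSet (Kerr.background M a) Ψ τ₀ L, ∀ x : ↥(Kerr.background M a).domain, x ∈ (Kerr.background M a).timeSlabIoo τ₀ L → ρ ≤ Kerr.radius a x → g x = Kerr.bilin M a x) → ∀ R : ℝ, Filter.Tendsto (fun τ : ℝ ↦ supCkENorm (Subtype.val '' {x : ↥(Kerr.background M a).domain | (x : E4) 0 = τ ∧ ρ ≤ Kerr.radius a x ∧ Kerr.radius a x ≤ R}) 2 (𝒟.toSpacetime.deviationExtend (Kerr.background M a) Ψ)) Filter.atTop (nhds 0) := by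
  sorry

/-! ## Composition: the crux BY NAME from the two stubs (real proof, no `sorry`) -/

/-- **A from K and U**: pointwise in the development — K gives the settles disjunct outright, or the bounded late
Kerr–Schild chart with Kerr ω-limits outside `ρ`; U upgrades the latter to the `C²` annular convergence, which is the
remnant disjunct of A with the same `(M, a, ρ, τ₀, Ψ)`. -/
theorem SettlesOutsidePhotonRegions_of :
    Sig.stub_omegaLimitsKerrOutside → Sig.stub_annularC2Upgrade → SettlesOutsidePhotonRegions := by
  intro hK hU X _ _ _ _ _ _ D hD 𝒟 hmax hscri
  rcases hK X D hD 𝒟 hmax hscri with hset | ⟨M, a, ρ, τ₀, L, Ψ, hM, ha, hL, hchart, hbd, hlim⟩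
  · exact Or.inl hset
  · exact Or.inr ⟨M, a, ρ, τ₀, Ψ, hM, ha, hchart,
      hU X D hD 𝒟 hmax hscri M a ρ τ₀ L Ψ hM ha hL hchart hbd hlim⟩

/-- The crux by name, closed modulo the two registered stubs. -/
theorem settlesOutsidePhotonRegions_of_stubs : SettlesOutsidePhotonRegions :=
  SettlesOutsidePhotonRegions_of stub_omegaLimitsKerrOutside stub_annularC2Upgrade

end Summit.FinalStateConjecture.FinalStateConjecture.Cruxes.SettlesOutsidePhotonRegions.Birth

end
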